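import Mathlib
import Literature.Analysis.FluidPDE.VectorCalculus
import Literature.Analysis.FluidPDE.WholeSpaceIBP
import HarnessLib

/-!
# `AffineBernoulli.AlignedStratumTrivial` — the two regularised transport fields
  (route `AffineBernoulli`, item stmt-NavierStokesRegularity-13663, helper file II)

Pointwise calculus for the vector fields used to integrate the transport law
`Dλ(y)[V y] = −(3/2) λ(y)`, `div V = 3/2` of the aligned stratum (helper file I):

* `G₁ = √(λ² + δ²) • V`:  `div G₁ = (3/2) δ² / √(λ² + δ²) ∈ (0, (3/2) δ]`
  (`AlignedStratum.divergence_fieldOne`, `…_nonneg`, `…_le`), and `‖G₁‖ ≤ ‖λ • V‖ + δ ‖V‖`;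
* `G₂ = (λ² + δ²)^{1/4} • V` (written `√(√(λ² + δ²)) • V`):
  `div G₂ = (3/2)(s₂(λ) − λ s₂'(λ)) ≥ (3/4) s₂(λ) ≥ (3/4) √|λ|`
  (`AlignedStratum.divergence_fieldTwo_ge`), and `‖G₂‖ ≤ √(‖λ • V‖ ‖V‖) + √δ ‖V‖`.

Everything is stated for an abstract scalar `lam` and field `V` at a point `y` carrying the two
hypotheses `div V y = 3/2`, `D lam (y)[V y] = −(3/2) lam y`; no fluid mechanics enters.

HONEST FRAMING: elementary calculus serving a Liouville lemma about HYPOTHETICAL self-similar Euler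
profiles; nothing here bears on the regularity problem itself.
-/

noncomputable section

set_option linter.dupNamespace false

namespace Summit.NavierStokesRegularity.NavierStokesRegularity.Theorems

open Set Function Filter Topology InnerProductSpace
open scoped RealInnerProductSpace
open Literature.Analysis.FluidPDE

namespace AlignedStratum

variable {E : Type*} [NormedAddCommGroup E] [InnerProductSpace ℝ E] [FiniteDimensional ℝ E]

/-! ### Divergence of `s(lam) • V` -/

/-- Chain rule for the divergence of `z ↦ s(lam z) • V z`:
`div (s∘lam • V)(y) = s(lam y) div V(y) + s'(lam y) · D lam(y)[V y]`. -/
theorem divergence_comp_smul {lam : E → ℝ} {V : E → E} {s : ℝ → ℝ} {s' : ℝ} {y : E}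
    (hs : HasDerivAt s s' (lam y)) (hlam : DifferentiableAt ℝ lam y)
    (hV : DifferentiableAt ℝ V y) :
    VectorCalculus.divergence (fun z => s (lam z) • V z) y =
      s (lam y) * VectorCalculus.divergence V y + s' * fderiv ℝ lam y (V y) := by
  have hcomp : HasFDerivAt (fun z => s (lam z)) (s' • fderiv ℝ lam y) y :=
    hs.comp_hasFDerivAt y hlam.hasFDerivAt
  rw [divergence_smul_apply hcomp.differentiableAt hV, real_inner_comm, gradient,
    InnerProductSpace.toDual_symm_apply, hcomp.fderiv]
  simp [smul_eq_mul]

/-- With the two structure constants of the aligned stratum, `div V = 3/2` and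
`D lam[V] = −(3/2) lam`, the divergence of `s(lam) • V` is `(3/2)(s(lam) − lam · s'(lam))`. -/
theorem divergence_comp_smul_of_transport {lam : E → ℝ} {V : E → E} {s : ℝ → ℝ} {s' : ℝ} {y : E}
    (hs : HasDerivAt s s' (lam y)) (hlam : DifferentiableAt ℝ lam y)
    (hV : DifferentiableAt ℝ V y) (hdivV : VectorCalculus.divergence V y = 3 / 2)
    (htr : fderiv ℝ lam y (V y) = -(3 / 2) * lam y) :
    VectorCalculus.divergence (fun z => s (lam z) • V z) y =
      (3 / 2) * (s (lam y) - lam y * s') := by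
  rw [divergence_comp_smul hs hlam hV, hdivV, htr]
  ring

/-! ### The profile `s₁(t) = √(t² + δ²)` -/

/-- `s₁(t) = √(t² + δ²)` has derivative `t / √(t² + δ²)` (`δ ≠ 0`). -/
theorem hasDerivAt_sqrt_sq_add {δ : ℝ} (hδ : δ ≠ 0) (t : ℝ) :
    HasDerivAt (fun t : ℝ => √(t ^ 2 + δ ^ 2)) (t / √(t ^ 2 + δ ^ 2)) t := by
  have hq : t ^ 2 + δ ^ 2 ≠ 0 := by positivity
  have h := ((hasDerivAt_pow 2 t).add_const (δ ^ 2)).sqrt hq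
  convert h using 1
  simp; ring

/-- The key algebra for `G₁`: `s₁(t) − t s₁'(t) = δ² / √(t² + δ²)`. -/
theorem sqrt_sq_add_sub_mul {δ : ℝ} (hδ : δ ≠ 0) (t : ℝ) :
    √(t ^ 2 + δ ^ 2) - t * (t / √(t ^ 2 + δ ^ 2)) = δ ^ 2 / √(t ^ 2 + δ ^ 2) := by
  have hq : 0 < t ^ 2 + δ ^ 2 := by positivity
  have hs : 0 < √(t ^ 2 + δ ^ 2) := Real.sqrt_pos.2 hq
  have hss : √(t ^ 2 + δ ^ 2) * √(t ^ 2 + δ ^ 2) = t ^ 2 + δ ^ 2 := Real.mul_self_sqrt hq.le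
  field_simp
  linarith [hss]

/-- `0 < δ² / √(t² + δ²) ≤ δ` for `δ > 0`. -/
theorem sq_div_sqrt_sq_add_pos_le {δ : ℝ} (hδ : 0 < δ) (t : ℝ) :
    0 < δ ^ 2 / √(t ^ 2 + δ ^ 2) ∧ δ ^ 2 / √(t ^ 2 + δ ^ 2) ≤ δ := by
  have hs : 0 < √(t ^ 2 + δ ^ 2) := Real.sqrt_pos.2 (by positivity)
  refine ⟨by positivity, ?_⟩
  rw [div_le_iff₀ hs]
  have hδs : δ ≤ √(t ^ 2 + δ ^ 2) := by
    calc δ = √(δ ^ 2) := (Real.sqrt_sq hδ.le).symm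
      _ ≤ √(t ^ 2 + δ ^ 2) := Real.sqrt_le_sqrt (by nlinarith)
  nlinarith

/-- `√(t² + δ²) ≤ |t| + δ` for `δ ≥ 0`. -/
theorem sqrt_sq_add_le {δ : ℝ} (hδ : 0 ≤ δ) (t : ℝ) : √(t ^ 2 + δ ^ 2) ≤ |t| + δ := by
  rw [Real.sqrt_le_left (by positivity)]
  nlinarith [abs_nonneg t, sq_abs t]

omit [FiniteDimensional ℝ E] in
/-- Size of `G₁`: `‖√(t² + δ²) • v‖ ≤ ‖t • v‖ + δ ‖v‖` (`δ ≥ 0`). -/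
theorem norm_sqrt_sq_add_smul_le {δ : ℝ} (hδ : 0 ≤ δ) (t : ℝ) (v : E) :
    ‖√(t ^ 2 + δ ^ 2) • v‖ ≤ ‖t • v‖ + δ * ‖v‖ := by
  rw [norm_smul, norm_smul, Real.norm_eq_abs, Real.norm_eq_abs,
    abs_of_nonneg (Real.sqrt_nonneg _), ← add_mul]
  exact mul_le_mul_of_nonneg_right (sqrt_sq_add_le hδ t) (norm_nonneg _)

omit [FiniteDimensional ℝ E] in
/-- `G₁ = √(lam² + δ²) • V` is `C¹` at points where `lam` and `V` are. -/
theorem contDiffAt_fieldOne {lam : E → ℝ} {V : E → E} {δ : ℝ} {y : E} (hδ : δ ≠ 0)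
    (hlam : ContDiffAt ℝ 1 lam y) (hV : ContDiffAt ℝ 1 V y) :
    ContDiffAt ℝ 1 (fun z => √(lam z ^ 2 + δ ^ 2) • V z) y := by
  have hq : ContDiffAt ℝ 1 (fun z => lam z ^ 2 + δ ^ 2) y := (hlam.pow 2).add contDiffAt_const
  exact (hq.sqrt (by positivity)).smul hV

/-- **Divergence of `G₁`.** Under `div V(y) = 3/2` and `D lam(y)[V y] = −(3/2) lam(y)`:
`div (√(lam² + δ²) • V)(y) = (3/2) δ² / √(lam(y)² + δ²)`. -/
theorem divergence_fieldOne {lam : E → ℝ} {V : E → E} {δ : ℝ} {y : E} (hδ : δ ≠ 0)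
    (hlam : DifferentiableAt ℝ lam y) (hV : DifferentiableAt ℝ V y)
    (hdivV : VectorCalculus.divergence V y = 3 / 2)
    (htr : fderiv ℝ lam y (V y) = -(3 / 2) * lam y) :
    VectorCalculus.divergence (fun z => √(lam z ^ 2 + δ ^ 2) • V z) y =
      (3 / 2) * (δ ^ 2 / √(lam y ^ 2 + δ ^ 2)) := by
  rw [divergence_comp_smul_of_transport (s := fun t : ℝ => √(t ^ 2 + δ ^ 2))
    (hasDerivAt_sqrt_sq_add hδ (lam y)) hlam hV hdivV htr, sqrt_sq_add_sub_mul hδ]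

/-- `0 ≤ div G₁ ≤ (3/2) δ` (for `δ > 0`). -/
theorem divergence_fieldOne_nonneg_le {lam : E → ℝ} {V : E → E} {δ : ℝ} {y : E} (hδ : 0 < δ)
    (hlam : DifferentiableAt ℝ lam y) (hV : DifferentiableAt ℝ V y)
    (hdivV : VectorCalculus.divergence V y = 3 / 2)
    (htr : fderiv ℝ lam y (V y) = -(3 / 2) * lam y) :
    0 ≤ VectorCalculus.divergence (fun z => √(lam z ^ 2 + δ ^ 2) • V z) y ∧
      VectorCalculus.divergence (fun z => √(lam z ^ 2 + δ ^ 2) • V z) y ≤ 3 / 2 * δ := by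
  rw [divergence_fieldOne hδ.ne' hlam hV hdivV htr]
  obtain ⟨h1, h2⟩ := sq_div_sqrt_sq_add_pos_le hδ (lam y)
  constructor <;> nlinarith

/-! ### The profile `s₂(t) = (t² + δ²)^{1/4} = √(√(t² + δ²))` -/

/-- `s₂(t) = √(√(t² + δ²))` has derivative `(t/√(t²+δ²)) / (2 √(√(t²+δ²)))` (`δ ≠ 0`). -/
theorem hasDerivAt_sqrt_sqrt_sq_add {δ : ℝ} (hδ : δ ≠ 0) (t : ℝ) :
    HasDerivAt (fun t : ℝ => √(√(t ^ 2 + δ ^ 2)))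
      ((t / √(t ^ 2 + δ ^ 2)) / (2 * √(√(t ^ 2 + δ ^ 2)))) t := by
  have hs : √(t ^ 2 + δ ^ 2) ≠ 0 := (Real.sqrt_pos.2 (by positivity)).ne'
  exact (hasDerivAt_sqrt_sq_add hδ t).sqrt hs

/-- The key algebra for `G₂`: `s₂(t) − t s₂'(t) ≥ s₂(t) / 2`
(indeed `= (t² + 2δ²) / (2 (t²+δ²)^{3/4})`). -/
theorem half_sqrt_sqrt_le_sub_mul {δ : ℝ} (hδ : δ ≠ 0) (t : ℝ) :
    √(√(t ^ 2 + δ ^ 2)) / 2 ≤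
      √(√(t ^ 2 + δ ^ 2)) - t * ((t / √(t ^ 2 + δ ^ 2)) / (2 * √(√(t ^ 2 + δ ^ 2)))) := by
  set q : ℝ := t ^ 2 + δ ^ 2 with hqdef
  have hq : 0 < q := by positivity
  have hs : 0 < √q := Real.sqrt_pos.2 hq
  have hr : 0 < √(√q) := Real.sqrt_pos.2 hs
  have hss : √q * √q = q := Real.mul_self_sqrt hq.le
  have hrr : √(√q) * √(√q) = √q := Real.mul_self_sqrt hs.le
  -- `t * s₂' = t² / (2 √q √√q)` and `√√q / 2 - t² / (2 √q √√q) = (q - t²) / (2 √q √√q) ≥ 0`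
  have key : t * ((t / √q) / (2 * √(√q))) ≤ √(√q) / 2 := by
    rw [show t * ((t / √q) / (2 * √(√q))) = t ^ 2 / (2 * (√q * √(√q))) by
      field_simp]
    rw [div_le_iff₀ (by positivity)]
    have h1 : √(√q) / 2 * (2 * (√q * √(√q))) = √q * (√(√q) * √(√q)) := by ring
    rw [h1, hrr, hss, hqdef]
    nlinarith [sq_nonneg δ]
  linarith

/-- `√|t| ≤ s₂(t) = √(√(t² + δ²))`. -/
theorem sqrt_abs_le_sqrt_sqrt_sq_add (δ t : ℝ) : √|t| ≤ √(√(t ^ 2 + δ ^ 2)) := by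
  refine Real.sqrt_le_sqrt ?_
  calc |t| = √(t ^ 2) := (Real.sqrt_sq_eq_abs t).symm
    _ ≤ √(t ^ 2 + δ ^ 2) := Real.sqrt_le_sqrt (by nlinarith)

/-- `0 < s₂(t)`. -/
theorem sqrt_sqrt_sq_add_pos {δ : ℝ} (hδ : δ ≠ 0) (t : ℝ) : 0 < √(√(t ^ 2 + δ ^ 2)) :=
  Real.sqrt_pos.2 (Real.sqrt_pos.2 (by positivity))

omit [FiniteDimensional ℝ E] in
/-- Size of `G₂`: `‖√(√(t² + δ²)) • v‖ ≤ √(‖t • v‖ ‖v‖) + √δ ‖v‖` (`δ ≥ 0`). -/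
theorem norm_sqrt_sqrt_sq_add_smul_le {δ : ℝ} (hδ : 0 ≤ δ) (t : ℝ) (v : E) :
    ‖√(√(t ^ 2 + δ ^ 2)) • v‖ ≤ √(‖t • v‖ * ‖v‖) + √δ * ‖v‖ := by
  rw [norm_smul, Real.norm_eq_abs, abs_of_nonneg (Real.sqrt_nonneg _)]
  have h1 : √(√(t ^ 2 + δ ^ 2)) ≤ √(|t| + δ) := Real.sqrt_le_sqrt (sqrt_sq_add_le hδ t)
  have h2 : √(|t| + δ) ≤ √|t| + √δ := by
    rw [Real.sqrt_le_left (by positivity)]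
    have := Real.mul_self_sqrt (abs_nonneg t)
    have := Real.mul_self_sqrt hδ
    nlinarith [Real.sqrt_nonneg |t|, Real.sqrt_nonneg δ]
  have h3 : √|t| * ‖v‖ = √(‖t • v‖ * ‖v‖) := by
    rw [norm_smul, Real.norm_eq_abs, mul_assoc, Real.sqrt_mul (abs_nonneg t),
      Real.sqrt_mul_self (norm_nonneg v)]
  calc √(√(t ^ 2 + δ ^ 2)) * ‖v‖ ≤ (√|t| + √δ) * ‖v‖ :=
        mul_le_mul_of_nonneg_right (h1.trans h2) (norm_nonneg v)
    _ = √(‖t • v‖ * ‖v‖) + √δ * ‖v‖ := by rw [add_mul, h3]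

omit [FiniteDimensional ℝ E] in
/-- `G₂ = √(√(lam² + δ²)) • V` is `C¹` at points where `lam` and `V` are. -/
theorem contDiffAt_fieldTwo {lam : E → ℝ} {V : E → E} {δ : ℝ} {y : E} (hδ : δ ≠ 0)
    (hlam : ContDiffAt ℝ 1 lam y) (hV : ContDiffAt ℝ 1 V y) :
    ContDiffAt ℝ 1 (fun z => √(√(lam z ^ 2 + δ ^ 2)) • V z) y := by
  have hq : ContDiffAt ℝ 1 (fun z => lam z ^ 2 + δ ^ 2) y := (hlam.pow 2).add contDiffAt_const
  have h1 : ContDiffAt ℝ 1 (fun z => √(lam z ^ 2 + δ ^ 2)) y := hq.sqrt (by positivity)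
  exact (h1.sqrt (Real.sqrt_pos.2 (by positivity)).ne').smul hV

/-- **Divergence of `G₂`**, lower bound. Under `div V(y) = 3/2` and
`D lam(y)[V y] = −(3/2) lam(y)`:  `(3/4) √(√(lam(y)² + δ²)) ≤ div (√(√(lam² + δ²)) • V)(y)`;
in particular `div G₂ ≥ (3/4) √|lam| ≥ 0`. -/
theorem divergence_fieldTwo_ge {lam : E → ℝ} {V : E → E} {δ : ℝ} {y : E} (hδ : δ ≠ 0)
    (hlam : DifferentiableAt ℝ lam y) (hV : DifferentiableAt ℝ V y)
    (hdivV : VectorCalculus.divergence V y = 3 / 2)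
    (htr : fderiv ℝ lam y (V y) = -(3 / 2) * lam y) :
    3 / 4 * √(√(lam y ^ 2 + δ ^ 2)) ≤
      VectorCalculus.divergence (fun z => √(√(lam z ^ 2 + δ ^ 2)) • V z) y := by
  rw [divergence_comp_smul_of_transport (s := fun t : ℝ => √(√(t ^ 2 + δ ^ 2)))
    (hasDerivAt_sqrt_sqrt_sq_add hδ (lam y)) hlam hV hdivV htr]
  have := half_sqrt_sqrt_le_sub_mul hδ (lam y)
  linarith

end AlignedStratum

end Summit.NavierStokesRegularity.NavierStokesRegularity.Theorems
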